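import Mathlib
import Summits.ResolutionOfSingularities.ResolutionOfSingularities.Theorems.WildQuotientsWildQuotientResolutionJordanFiveTwistedChartDefs
import Summits.ResolutionOfSingularities.ResolutionOfSingularities.Theorems.WildQuotientsWildQuotientResolutionJordanFourTwistedChartInvariants

/-!
# R-T rung (J₅) — the universal twisted chart at the `μ₃`-vertex: equivariance T5-i, the invariants on the chart T5-iii, the new invariants `i₂`, `2j₃`

(crux stmt-ResolutionOfSingularities-15640 `WildQuotients.WildQuotientResolution`, line `Sketch`,
sector `|G| = p`; programme «R-T twisted root charts in general» of `L/w45c/CHAIN.md` v7.9 §5,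
design memo `L/res-L1-w45c-idea-2/RT-J5.md` §1/§2/§4 (ideator res-L1-w45c-idea-2); every identity
below was re-derived symbolically in kit j275294 (this seat) before typing, and is here transported
to the project vocabulary of `…JordanFiveTwistedChartDefs` / `…JordanFourTwistedChartDefs`.
[OURS · L1 W4.5c] — NOT a statement of any manuscript (Hironaka 2017 is consumed nowhere); replaces
the role of no printed item. Prover res-L1-w45c-stub-1. AI-written Lean, kernel-checked; weaker than
expert review.)

Slots `l = X b`, `A = X a`, `ξ = X c`, `η₁ = X d`, `η₂ = X e`; `ψ₅ = JordanFive.twistedChart k n a b c d e`;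
`2, 3 ∈ kˣ` (hypotheses `(2 : k) ≠ 0`, `(3 : k) ≠ 0`, i.e. `char k ≥ 5`). The maps `σ` (the `J₅`
datum) and `Σ_l` (the translation `ξ ↦ ξ + l`) are ARBITRARY `k`-algebra endomorphisms given by
their laws on the variables.

* T5-i `twistedChart_comp_eq` / `twistedChart_map`: **`ψ₅ ∘ σ = Σ_l ∘ ψ₅`** (five generator
  identities `translate_twistedChart_X_a/b/c/d/e`) — on the chart the wild automorphism of order
  `p` IS the polynomial Artin–Schreier translation `ξ ↦ ξ + l`.
* T5-iii (the J₄ invariants, which involve `x_a,…,x_d` only, on the J₅ chart; `Q = JordanFour.twistedQ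
  = 1 − 3lA + A²η₁`): `twistedChart_hPrime : ψ₅(H') = l⁶Q`, `twistedChart_tPrime : ψ₅(T') = l⁹Q`
  (so `l³ = T'/H'`: the chart is the `μ₃`-TWISTED cube-root cover), `X_b_mul_twistedChart_mSlice :
  l·ψ₅(M) = ξ·l⁶Q` (the SLICE `ξ = lM/H'`), `twistedChart_delta7 : ψ₅(Δ₇) = l¹⁹Q³η₁`
  (`η₁ = Δ₇/(lH'³)`), with the `ψ₅(H')`-relative forms `twistedChart_tPrime_eq`,
  `X_b_mul_twistedChart_mSlice_eq`, `twistedChart_delta7_eq`.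
* The NEW invariants: `map_iTwo`, `map_jThreeTwo` (`σ`-invariance upstairs, with `map_hPrime`,
  `map_tPrime`, `map_mSlice`, `map_delta7` restated for the `J₅` law — the J₄ versions assume `σ`
  fixes every `x_i`, `i ∉ {b,c,d}`, which fails at `x_e`), the degree-`6` syzygy `syzygy_six`, and
  their values `twelve_mul_twistedChart_iTwo : 12·ψ₅(i₂) = l⁴(3A²η₁² − 6A²l²η₁ − 12Alη₁ + 24Aη₂ +
  24Al³ + 4η₁ − 8l²)`, `four_mul_twistedChart_jThreeTwo : 4·ψ₅(2j₃) = −l⁶Q(24η₂ − Aη₁² + 2Al²η₁)` —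
  the last one is the birational inverse for `η₂` (RT-J5 §4: `(i₂, j₃)` alone is `3 : 1`, the
  integration constants `(η₁, η₂)` are the coordinates).
Method: cleared forms (`two_mul_twistedChart_X_c`, `six_mul_twistedChart_X_d`,
`twentyFour_mul_twistedChart_X_e`, `JordanFour.two_mul_twistedP`) as `linear_combination`
hypotheses with machine-extracted polynomial cofactors (kit j275294, successive division by the
cleared relations in the atoms `P`, `ψ₅(x_d)`, `ψ₅(x_e)`); `Δ₇` through its defining relation
`x_a²Δ₇ = T'H'³ − T'³ + 3x_aT'²H'` and cancellation of the non-zero-divisor `l⁸A²`.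
-/

-- single-problem summit: the doubled namespace component `ResolutionOfSingularities` is forced
set_option linter.dupNamespace false

noncomputable section

open MvPolynomial

namespace Summit.ResolutionOfSingularities.ResolutionOfSingularities.Theorems.WildQuotientResolution.JordanFive

section Equivariance

variable (k : Type) [Field k] (n : ℕ) (a b c d e : Fin n)
  (hab : a ≠ b) (hac : a ≠ c) (had : a ≠ d) (hae : a ≠ e) (hbc : b ≠ c) (hbd : b ≠ d) (hbe : b ≠ e)
  (hcd : c ≠ d) (hce : c ≠ e) (hde : d ≠ e)
  (τ : MvPolynomial (Fin n) k →ₐ[k] MvPolynomial (Fin n) k)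
  (hτc : τ (X c) = X c + X b) (hτ : ∀ i, i ≠ c → τ (X i) = X i)

/-! ### T5-i EQUIVARIANCE `ψ₅ ∘ σ = Σ_l ∘ ψ₅`: on the chart `σ` is the translation `ξ ↦ ξ + l`
(`Σ_l (X c) = X c + X b`, all other variables fixed), for ANY `k`-algebra endomorphisms `σ`, `Σ_l`
with the stated laws. Each generator identity is proved on its cleared form. -/

include hac hbc hτ in
/-- `Σ_l ψ₅(x_a) = ψ₅(x_a)` (`= ψ₅(σ x_a)`). [OURS · L1 W4.5c] -/
theorem translate_twistedChart_X_a :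
    τ (twistedChart k n a b c d e (X a)) = twistedChart k n a b c d e (X a) := by
  rw [twistedChart_X_a, map_mul, map_pow, hτ a hac, hτ b hbc]

include hab hac hbc hτc hτ in
/-- `Σ_l ψ₅(x_b) = ψ₅(x_b) + ψ₅(x_a)` (`= ψ₅(σ x_b)`). [OURS · L1 W4.5c] -/
theorem translate_twistedChart_X_b :
    τ (twistedChart k n a b c d e (X b)) =
      twistedChart k n a b c d e (X b) + twistedChart k n a b c d e (X a) := by
  rw [twistedChart_X_b k n a b c d e hab, twistedChart_X_a]
  simp only [map_mul, map_pow, map_add, map_one, hτ a hac, hτ b hbc, hτc]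
  ring

include hab hac hbc hcd hτc hτ in
/-- `Σ_l ψ₅(x_c) = ψ₅(x_c) + ψ₅(x_b)` (`= ψ₅(σ x_c)`): the correction `(A/2)(ξ² − lξ − η₁)` absorbs
the non-linearity (cleared by `2`). [OURS · L1 W4.5c] -/
theorem translate_twistedChart_X_c (h2 : (2 : k) ≠ 0) :
    τ (twistedChart k n a b c d e (X c)) =
      twistedChart k n a b c d e (X c) + twistedChart k n a b c d e (X b) := by
  refine mul_left_cancel₀ (two_ne_zero_poly k n h2) ?_
  rw [show (2 : MvPolynomial (Fin n) k) * τ (twistedChart k n a b c d e (X c)) =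
      τ (2 * twistedChart k n a b c d e (X c)) by rw [map_mul, map_ofNat],
    two_mul_twistedChart_X_c k n a b c d e hac hbc h2,
    mul_add (2 : MvPolynomial (Fin n) k) (twistedChart k n a b c d e (X c)),
    two_mul_twistedChart_X_c k n a b c d e hac hbc h2, twistedChart_X_b k n a b c d e hab]
  simp only [map_mul, map_pow, map_add, map_sub, map_ofNat, hτ a hac, hτ b hbc, hτ d (Ne.symm hcd),
    hτc]
  ring

include hac had hbc hbd hcd hτc hτ in
/-- `Σ_l ψ₅(x_d) = ψ₅(x_d) + ψ₅(x_c)` (`= ψ₅(σ x_d)`; cleared by `6`). [OURS · L1 W4.5c] -/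
theorem translate_twistedChart_X_d (h2 : (2 : k) ≠ 0) (h3 : (3 : k) ≠ 0) :
    τ (twistedChart k n a b c d e (X d)) =
      twistedChart k n a b c d e (X d) + twistedChart k n a b c d e (X c) := by
  refine mul_left_cancel₀ (JordanFour.six_ne_zero' k n h2 h3) ?_
  rw [show (6 : MvPolynomial (Fin n) k) * τ (twistedChart k n a b c d e (X d)) =
      τ (6 * twistedChart k n a b c d e (X d)) by rw [map_mul, map_ofNat],
    six_mul_twistedChart_X_d k n a b c d e had hbd hcd h2 h3, mul_add,
    six_mul_twistedChart_X_d k n a b c d e had hbd hcd h2 h3,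
    show (6 : MvPolynomial (Fin n) k) * twistedChart k n a b c d e (X c) =
      3 * (2 * twistedChart k n a b c d e (X c)) by ring,
    two_mul_twistedChart_X_c k n a b c d e hac hbc h2]
  simp only [twistedD, map_mul, map_pow, map_add, map_sub, map_ofNat, hτ a hac, hτ b hbc,
    hτ d (Ne.symm hcd), hτc]
  ring

include hac had hae hbc hbd hbe hcd hce hde hτc hτ in
/-- `Σ_l ψ₅(x_e) = ψ₅(x_e) + ψ₅(x_d)` (`= ψ₅(σ x_e)`; cleared by `24`): the `F`-recursion of
RT-J5 §1 (C) at `k = 4` — the new integration constant `η₂` is untouched. [OURS · L1 W4.5c] -/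
theorem translate_twistedChart_X_e (h2 : (2 : k) ≠ 0) (h3 : (3 : k) ≠ 0) :
    τ (twistedChart k n a b c d e (X e)) =
      twistedChart k n a b c d e (X e) + twistedChart k n a b c d e (X d) := by
  refine mul_left_cancel₀ (twentyFour_ne_zero_poly k n h2 h3) ?_
  rw [show (24 : MvPolynomial (Fin n) k) * τ (twistedChart k n a b c d e (X e)) =
      τ (24 * twistedChart k n a b c d e (X e)) by rw [map_mul, map_ofNat],
    twentyFour_mul_twistedChart_X_e k n a b c d e hae hbe hce hde h2 h3, mul_add,
    twentyFour_mul_twistedChart_X_e k n a b c d e hae hbe hce hde h2 h3,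
    show (24 : MvPolynomial (Fin n) k) * twistedChart k n a b c d e (X d) =
      4 * (6 * twistedChart k n a b c d e (X d)) by ring,
    six_mul_twistedChart_X_d k n a b c d e had hbd hcd h2 h3]
  simp only [twistedE, twistedD, map_mul, map_pow, map_add, map_sub, map_ofNat, hτ a hac, hτ b hbc,
    hτ d (Ne.symm hcd), hτ e (Ne.symm hce), hτc]
  ring

variable (σ : MvPolynomial (Fin n) k →ₐ[k] MvPolynomial (Fin n) k)
  (hσb : σ (X b) = X b + X a) (hσc : σ (X c) = X c + X b) (hσd : σ (X d) = X d + X c)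
  (hσe : σ (X e) = X e + X d)
  (hσ : ∀ i, i ≠ b → i ≠ c → i ≠ d → i ≠ e → σ (X i) = X i)

include hab hac had hae hbc hbd hbe hcd hce hde hτc hτ hσb hσc hσd hσe hσ in
/-- **T5-i EQUIVARIANCE `ψ₅ ∘ σ = Σ_l ∘ ψ₅`** for the `J₅` datum `σ` (`x_b ↦ x_b + x_a`,
`x_c ↦ x_c + x_b`, `x_d ↦ x_d + x_c`, `x_e ↦ x_e + x_d`, rest fixed) and the translation `Σ_l`
(`ξ ↦ ξ + l`, rest fixed): on the universal twisted chart the wild automorphism IS a polynomial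
Artin–Schreier translation. [OURS · L1 W4.5c] -/
theorem twistedChart_comp_eq (h2 : (2 : k) ≠ 0) (h3 : (3 : k) ≠ 0) :
    (twistedChart k n a b c d e).comp σ = τ.comp (twistedChart k n a b c d e) := by
  refine MvPolynomial.algHom_ext fun i => ?_
  change twistedChart k n a b c d e (σ (X i)) = τ (twistedChart k n a b c d e (X i))
  by_cases hib : i = b
  · subst hib
    rw [hσb, map_add, translate_twistedChart_X_b k n a i c d e hab hac hbc τ hτc hτ]
  by_cases hic : i = c
  · subst hic
    rw [hσc, map_add, translate_twistedChart_X_c k n a b i d e hab hac hbc hcd τ hτc hτ h2]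
  by_cases hid : i = d
  · subst hid
    rw [hσd, map_add, translate_twistedChart_X_d k n a b c i e hac had hbc hbd hcd τ hτc hτ h2 h3]
  by_cases hie : i = e
  · subst hie
    rw [hσe, map_add,
      translate_twistedChart_X_e k n a b c d i hac had hae hbc hbd hbe hcd hce hde τ hτc hτ h2 h3]
  rw [hσ i hib hic hid hie]
  by_cases hia : i = a
  · subst hia
    rw [translate_twistedChart_X_a k n i b c d e hac hbc τ hτ]
  rw [twistedChart_X_of_ne k n a b c d e i hia hib hic hid hie, hτ i hic]

include hab hac had hae hbc hbd hbe hcd hce hde hτc hτ hσb hσc hσd hσe hσ in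
/-- T5-i pointwise: `ψ₅(σ f) = Σ_l(ψ₅ f)` for every `f`. [OURS · L1 W4.5c] -/
theorem twistedChart_map (h2 : (2 : k) ≠ 0) (h3 : (3 : k) ≠ 0) (f : MvPolynomial (Fin n) k) :
    twistedChart k n a b c d e (σ f) = τ (twistedChart k n a b c d e f) := by
  have h := twistedChart_comp_eq k n a b c d e hab hac had hae hbc hbd hbe hcd hce hde τ hτc hτ σ
    hσb hσc hσd hσe hσ h2 h3
  exact congrArg (fun φ : MvPolynomial (Fin n) k →ₐ[k] MvPolynomial (Fin n) k => φ f) h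

end Equivariance

section Invariants

variable (k : Type) [Field k] (n : ℕ) (a b c d e : Fin n)
  (hab : a ≠ b) (hac : a ≠ c) (had : a ≠ d) (hae : a ≠ e) (hbc : b ≠ c) (hbd : b ≠ d) (hbe : b ≠ e)
  (hcd : c ≠ d) (hce : c ≠ e) (hde : d ≠ e)

/-! ### T5-iii the J₄ invariants `H'`, `T'`, `M`, `Δ₇` on the J₅ chart -/

include hab hac hbc in
/-- **`ψ₅(H') = l⁶ Q`.** [OURS · L1 W4.5c] -/
theorem twistedChart_hPrime (h2 : (2 : k) ≠ 0) :
    twistedChart k n a b c d e (JordanFour.hPrime k n a b c) = X b ^ 6 * JordanFour.twistedQ k n a b d := by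
  have hP := JordanFour.two_mul_twistedP k n a b c d h2
  simp only [JordanFour.hPrime, JordanFour.twistedQ, map_sub, map_mul, map_pow, map_ofNat,
    twistedChart_X_a, twistedChart_X_b k n a b c d e hab, twistedChart_X_c k n a b c d e hac hbc]
  linear_combination (-(X a * X b ^ 6)) * hP

include hab hac had hbc hbd hcd in
/-- **`ψ₅(T') = l⁹ Q`** (hence `l³ = T'/H'` on the chart: the twisted cube root). [OURS · L1 W4.5c] -/
theorem twistedChart_tPrime (h2 : (2 : k) ≠ 0) (h3 : (3 : k) ≠ 0) :
    twistedChart k n a b c d e (JordanFour.tPrime k n a b c d) =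
      X b ^ 9 * JordanFour.twistedQ k n a b d := by
  have hP := JordanFour.two_mul_twistedP k n a b c d h2
  have hD := six_mul_twistedChart_X_d k n a b c d e had hbd hcd h2 h3
  rw [twistedD] at hD
  refine mul_left_cancel₀ (two_ne_zero_poly k n h2) ?_
  simp only [JordanFour.tPrime, JordanFour.twistedQ, map_sub, map_add, map_mul, map_pow, map_ofNat,
    twistedChart_X_a, twistedChart_X_b k n a b c d e hab, twistedChart_X_c k n a b c d e hac hbc]
  linear_combination (X a ^ 2 * X b ^ 8) * hD +
    (-(3 * (X a ^ 2 * X b ^ 9 * X c)) - 3 * (X a * X b ^ 9)) * hP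

include hab hac had hbc hbd hcd in
/-- **The slice: `l·ψ₅(M) = ξ·l⁶Q`** (`ξ = lM/H'` on the chart). [OURS · L1 W4.5c] -/
theorem X_b_mul_twistedChart_mSlice (h2 : (2 : k) ≠ 0) (h3 : (3 : k) ≠ 0) :
    X b * twistedChart k n a b c d e (JordanFour.mSlice k n a b c d) =
      X c * (X b ^ 6 * JordanFour.twistedQ k n a b d) := by
  have hP := JordanFour.two_mul_twistedP k n a b c d h2
  have hD := six_mul_twistedChart_X_d k n a b c d e had hbd hcd h2 h3
  rw [twistedD] at hD
  refine mul_left_cancel₀ (two_ne_zero_poly k n h2) ?_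
  simp only [JordanFour.mSlice, JordanFour.twistedQ, map_sub, map_add, map_mul, map_pow, map_ofNat,
    twistedChart_X_a, twistedChart_X_b k n a b c d e hab, twistedChart_X_c k n a b c d e hac hbc]
  linear_combination (-(X a * X b ^ 5)) * hD + (X a * X b ^ 6 * X c + X b ^ 6) * hP

include hab hac had hbc hbd hcd in
/-- `ψ₅(T') = l³·ψ₅(H')`. [OURS · L1 W4.5c] -/
theorem twistedChart_tPrime_eq (h2 : (2 : k) ≠ 0) (h3 : (3 : k) ≠ 0) :
    twistedChart k n a b c d e (JordanFour.tPrime k n a b c d) =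
      X b ^ 3 * twistedChart k n a b c d e (JordanFour.hPrime k n a b c) := by
  rw [twistedChart_tPrime k n a b c d e hab hac had hbc hbd hcd h2 h3,
    twistedChart_hPrime k n a b c d e hab hac hbc h2]
  ring

include hab hac had hbc hbd hcd in
/-- `l·ψ₅(M) = ξ·ψ₅(H')`. [OURS · L1 W4.5c] -/
theorem X_b_mul_twistedChart_mSlice_eq (h2 : (2 : k) ≠ 0) (h3 : (3 : k) ≠ 0) :
    X b * twistedChart k n a b c d e (JordanFour.mSlice k n a b c d) =
      X c * twistedChart k n a b c d e (JordanFour.hPrime k n a b c) := by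
  rw [X_b_mul_twistedChart_mSlice k n a b c d e hab hac had hbc hbd hcd h2 h3,
    twistedChart_hPrime k n a b c d e hab hac hbc h2]

include hab hac had hbc hbd hcd in
/-- **`ψ₅(Δ₇) = l¹⁹ Q³ η₁`** (through `x_a²Δ₇ = T'H'³ − T'³ + 3x_aT'²H'`, cancelling `l⁸A²`).
[OURS · L1 W4.5c] -/
theorem twistedChart_delta7 (h2 : (2 : k) ≠ 0) (h3 : (3 : k) ≠ 0) :
    twistedChart k n a b c d e (JordanFour.delta7 k n a b c d) =
      X b ^ 19 * X d * JordanFour.twistedQ k n a b d ^ 3 := by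
  have hne : (X b ^ 4 * X a : MvPolynomial (Fin n) k) ^ 2 ≠ 0 :=
    pow_ne_zero _ (mul_ne_zero (pow_ne_zero _ (X_ne_zero b)) (X_ne_zero a))
  refine mul_left_cancel₀ hne ?_
  have h := congrArg (twistedChart k n a b c d e) (JordanFour.X_a_sq_mul_delta7 k n a b c d)
  rw [map_mul, map_pow, twistedChart_X_a] at h
  rw [h]
  simp only [map_sub, map_add, map_mul, map_pow, map_ofNat, twistedChart_X_a,
    twistedChart_hPrime k n a b c d e hab hac hbc h2,
    twistedChart_tPrime k n a b c d e hab hac had hbc hbd hcd h2 h3, JordanFour.twistedQ]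
  ring

include hab hac had hbc hbd hcd in
/-- `ψ₅(Δ₇) = l·η₁·ψ₅(H')³`. [OURS · L1 W4.5c] -/
theorem twistedChart_delta7_eq (h2 : (2 : k) ≠ 0) (h3 : (3 : k) ≠ 0) :
    twistedChart k n a b c d e (JordanFour.delta7 k n a b c d) =
      X b * X d * twistedChart k n a b c d e (JordanFour.hPrime k n a b c) ^ 3 := by
  rw [twistedChart_delta7 k n a b c d e hab hac had hbc hbd hcd h2 h3,
    twistedChart_hPrime k n a b c d e hab hac hbc h2]
  ring

/-! ### The new invariants `i₂`, `2j₃` on the chart (birational inverse for `η₂`) -/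

include hab hac had hae hbc hbd hbe hcd hce hde in
/-- **`12·ψ₅(i₂) = l⁴(3A²η₁² − 6A²l²η₁ − 12Alη₁ + 24Aη₂ + 24Al³ + 4η₁ − 8l²)`** (RT-J5 §4; `ξ`-free).
[OURS · L1 W4.5c] -/
theorem twelve_mul_twistedChart_iTwo (h2 : (2 : k) ≠ 0) (h3 : (3 : k) ≠ 0) :
    12 * twistedChart k n a b c d e (iTwo k n a b c d e) =
      X b ^ 4 * (3 * (X a ^ 2 * X d ^ 2) - 6 * (X a ^ 2 * X b ^ 2 * X d) - 12 * (X a * X b * X d) +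
        24 * (X a * X e) + 24 * (X a * X b ^ 3) + 4 * X d - 8 * X b ^ 2) := by
  have hP := JordanFour.two_mul_twistedP k n a b c d h2
  have hD := six_mul_twistedChart_X_d k n a b c d e had hbd hcd h2 h3
  have hE := twentyFour_mul_twistedChart_X_e k n a b c d e hae hbe hce hde h2 h3
  rw [twistedD] at hD
  rw [twistedE] at hE
  simp only [iTwo, map_sub, map_add, map_mul, map_pow, map_ofNat, twistedChart_X_a,
    twistedChart_X_b k n a b c d e hab, twistedChart_X_c k n a b c d e hac hbc]
  linear_combination (X a * X b ^ 4) * hE +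
    (6 * (X a * X b ^ 4) - 4 * (X a * X b ^ 3 * X c) - 4 * X b ^ 3) * hD +
    (-(3 * (X a * X d * X b ^ 4)) + 6 * (X a * X b ^ 6) - 9 * (X a * X b ^ 5 * X c) +
      3 * (X a * X b ^ 4 * X c ^ 2) + 6 * (X b ^ 4 * JordanFour.twistedP k n a b c d) +
      6 * (X b ^ 4 * X c)) * hP

include hab hac had hae hbc hbd hbe hcd hce hde in
/-- **`4·ψ₅(2j₃) = −l⁶Q·(24η₂ − Aη₁² + 2Al²η₁)`** (RT-J5 §4): the birational inverse for the new
integration constant, `24η₂ = −8j₃/(l⁶Q) + Aη₁² − 2Al²η₁`. [OURS · L1 W4.5c] -/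
theorem four_mul_twistedChart_jThreeTwo (h2 : (2 : k) ≠ 0) (h3 : (3 : k) ≠ 0) :
    4 * twistedChart k n a b c d e (jThreeTwo k n a b c d e) =
      -(X b ^ 6 * JordanFour.twistedQ k n a b d *
        (24 * X e - X a * X d ^ 2 + 2 * (X a * X b ^ 2 * X d))) := by
  have hP := JordanFour.two_mul_twistedP k n a b c d h2
  have hD := six_mul_twistedChart_X_d k n a b c d e had hbd hcd h2 h3
  have hE := twentyFour_mul_twistedChart_X_e k n a b c d e hae hbe hce hde h2 h3
  rw [twistedD] at hD
  rw [twistedE] at hE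
  simp only [jThreeTwo, JordanFour.twistedQ, map_sub, map_add, map_mul, map_pow, map_ofNat,
    twistedChart_X_a, twistedChart_X_b k n a b c d e hab, twistedChart_X_c k n a b c d e hac hbc]
  linear_combination (X a ^ 2 * X b ^ 7 * X c - X a ^ 2 * X b ^ 6 * X c ^ 2 + X a * X b ^ 7 +
      2 * (X a * X b ^ 6 * JordanFour.twistedP k n a b c d) - 2 * (X a * X b ^ 6 * X c) - X b ^ 6) * hE +
    (3 * (X a ^ 2 * X d * X b ^ 5 * X c) + 2 * (X a ^ 2 * X b ^ 7 * X c) - X a ^ 2 * X b ^ 6 * X c ^ 2 -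
      X a ^ 2 * X b ^ 5 * X c ^ 3 + X a * X d * X b ^ 5 + 2 * (X a * X b ^ 7) -
      11 * (X a * X b ^ 6 * X c) + 4 * (X a * X b ^ 5 * JordanFour.twistedP k n a b c d * X c) -
      3 * (X a * X b ^ 5 * X c ^ 2) - 6 * (X a * X b ^ 4 * twistedChart k n a b c d e (X d)) -
      4 * X b ^ 6 + 4 * (X b ^ 5 * JordanFour.twistedP k n a b c d)) * hD +
    (-(X a ^ 2 * X d ^ 2 * X b ^ 6) + 2 * (X a ^ 2 * X d * X b ^ 8) + X a ^ 2 * X d * X b ^ 7 * X c -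
      10 * (X a ^ 2 * X d * X b ^ 6 * X c ^ 2) - 2 * (X a ^ 2 * X b ^ 9 * X c) +
      7 * (X a ^ 2 * X b ^ 8 * X c ^ 2) - 7 * (X a ^ 2 * X b ^ 7 * X c ^ 3) +
      2 * (X a ^ 2 * X b ^ 6 * X c ^ 4) + X a * X d * X b ^ 7 +
      2 * (X a * X d * X b ^ 6 * JordanFour.twistedP k n a b c d) - 8 * (X a * X d * X b ^ 6 * X c) +
      24 * (X a * X e * X b ^ 6) - 2 * (X a * X b ^ 9) -
      4 * (X a * X b ^ 8 * JordanFour.twistedP k n a b c d) + 11 * (X a * X b ^ 8 * X c) +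
      8 * (X a * X b ^ 7 * JordanFour.twistedP k n a b c d * X c) + 9 * (X a * X b ^ 7 * X c ^ 2) -
      2 * (X a * X b ^ 6 * JordanFour.twistedP k n a b c d * X c ^ 2) + 8 * (X a * X b ^ 6 * X c ^ 3) -
      2 * (X d * X b ^ 6) + 4 * X b ^ 8 + 2 * (X b ^ 7 * JordanFour.twistedP k n a b c d) +
      4 * (X b ^ 7 * X c) - 4 * (X b ^ 6 * JordanFour.twistedP k n a b c d ^ 2) -
      4 * (X b ^ 6 * JordanFour.twistedP k n a b c d * X c) + 2 * (X b ^ 6 * X c ^ 2)) * hP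

end Invariants

section Upstairs

/-! ### The invariants upstairs for the `J₅` law (every characteristic; `σ` ANY `k`-algebra
endomorphism with `σ x_a = x_a`, `σ x_b = x_b + x_a`, …, `σ x_e = x_e + x_d`) -/

variable (k : Type) [Field k] (n : ℕ) (a b c d e : Fin n)
  (σ : MvPolynomial (Fin n) k →ₐ[k] MvPolynomial (Fin n) k)
  (hσa : σ (X a) = X a) (hσb : σ (X b) = X b + X a) (hσc : σ (X c) = X c + X b)
  (hσd : σ (X d) = X d + X c) (hσe : σ (X e) = X e + X d)

include hσa hσb hσc in
/-- `σ H' = H'` (any `J_n`, `n ≥ 3`: only `σ x_a, σ x_b, σ x_c` are used). [OURS · L1 W4.5c] -/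
theorem map_hPrime : σ (JordanFour.hPrime k n a b c) = JordanFour.hPrime k n a b c := by
  simp only [JordanFour.hPrime, map_sub, map_mul, map_pow, map_ofNat, hσa, hσb, hσc]
  ring

include hσa hσb hσc hσd in
/-- `σ T' = T'` (any `J_n`, `n ≥ 4`). [OURS · L1 W4.5c] -/
theorem map_tPrime : σ (JordanFour.tPrime k n a b c d) = JordanFour.tPrime k n a b c d := by
  simp only [JordanFour.tPrime, map_sub, map_add, map_mul, map_pow, map_ofNat, hσa, hσb, hσc, hσd]
  ring

include hσa hσb hσc hσd in
/-- **The slice upstairs: `σ M = M + H'`** (any `J_n`, `n ≥ 4`). [OURS · L1 W4.5c] -/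
theorem map_mSlice :
    σ (JordanFour.mSlice k n a b c d) = JordanFour.mSlice k n a b c d + JordanFour.hPrime k n a b c := by
  simp only [JordanFour.mSlice, JordanFour.hPrime, map_sub, map_add, map_mul, map_pow, map_ofNat, hσa,
    hσb, hσc, hσd]
  ring

include hσa hσb hσc hσd in
/-- `σ Δ₇ = Δ₇` (any `J_n`, `n ≥ 4`; through the defining relation, cancelling `x_a²`).
[OURS · L1 W4.5c] -/
theorem map_delta7 : σ (JordanFour.delta7 k n a b c d) = JordanFour.delta7 k n a b c d := by
  have hne : (X a : MvPolynomial (Fin n) k) ^ 2 ≠ 0 := pow_ne_zero _ (X_ne_zero a)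
  refine mul_left_cancel₀ hne ?_
  have h := congrArg σ (JordanFour.X_a_sq_mul_delta7 k n a b c d)
  rw [map_mul, map_pow, hσa] at h
  rw [h, JordanFour.X_a_sq_mul_delta7]
  simp only [map_sub, map_add, map_mul, map_pow, map_ofNat, hσa, map_hPrime k n a b c σ hσa hσb hσc,
    map_tPrime k n a b c d σ hσa hσb hσc hσd]

include hσa hσb hσc hσd hσe in
/-- **`σ i₂ = i₂`.** [OURS · L1 W4.5c] -/
theorem map_iTwo : σ (iTwo k n a b c d e) = iTwo k n a b c d e := by
  simp only [iTwo, map_sub, map_add, map_mul, map_pow, map_ofNat, hσa, hσb, hσc, hσd, hσe]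
  ring

include hσa hσb hσc hσd hσe in
/-- **`σ (2j₃) = 2j₃`.** [OURS · L1 W4.5c] -/
theorem map_jThreeTwo : σ (jThreeTwo k n a b c d e) = jThreeTwo k n a b c d e := by
  simp only [jThreeTwo, map_sub, map_add, map_mul, map_pow, map_ofNat, hσa, hσb, hσc, hσd, hσe]
  ring

/-- **The degree-`6` syzygy** `T'² − H'³ − 3x_aT'H' + 2x_a²H'² + 3x_a²H'·i₂ + x_a³·(2j₃) = 0` — the
unique relation among the `J₅` invariants of degree `≤ 3` in degree `6` (RT-J5 §2). [OURS · L1 W4.5c] -/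
theorem syzygy_six :
    JordanFour.tPrime k n a b c d ^ 2 - JordanFour.hPrime k n a b c ^ 3 -
        3 * (X a * JordanFour.tPrime k n a b c d * JordanFour.hPrime k n a b c) +
        2 * (X a ^ 2 * JordanFour.hPrime k n a b c ^ 2) +
        3 * (X a ^ 2 * JordanFour.hPrime k n a b c * iTwo k n a b c d e) +
        X a ^ 3 * jThreeTwo k n a b c d e = 0 := by
  simp only [JordanFour.tPrime, JordanFour.hPrime, iTwo, jThreeTwo]
  ring

end Upstairs

end Summit.ResolutionOfSingularities.ResolutionOfSingularities.Theorems.WildQuotientResolution.JordanFive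

end
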